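import Literature.Probability.Percolation.QuadCrossingCaseOneTopology
import Literature.Probability.Percolation.QuadCrossingRawClosed
import Literature.Probability.Percolation.QuadCrossingSubquadArm
import Literature.Probability.Percolation.QuadCrossingDuality
import Literature.Probability.Percolation.AnnulusCrossingBoundProofs
import Literature.Probability.Percolation.QuadCrossingPathCrossings
import Literature.Probability.Percolation.QuadCrossingPathReparam
import Literature.Probability.Percolation.OpenPathAnnulusCrossing
import Literature.Probability.Percolation.DualFaceChains
import HarnessLib

/-!
# Schramm–Smirnov's Lemma 6.1, case (1): re-cornering a quad changes the crossing event little

Topic `Probability/Percolation`; proofs file towards the named fact `SchrammSmirnov2011_lemma_6_1`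
(`QuadCrossingContinuity.lean`; O. Schramm, S. Smirnov, *On the scaling limits of planar
percolation*, Ann. Probab. 39 (2011), arXiv:1101.5820, §6, p. 22).  Condition (1) of the lemma
(`Quad.IsPerturbationOne`): `[Q'] = [Q]`, `∂₀Q' = ∂₀Q`, `∂₁Q' = ∂₁Q`, and a path `γ ⊂ [Q]` of
diameter `≤ ρ` separates both corners `Q(1,1)`, `Q'(1,1)` from `∂₀Q ∪ ∂₁Q` inside `[Q]`.  Printed
proof: "Suppose first that `d = d₀`.  The event `⊞_Q Δ ⊞_{Q'}` is contained in the event that there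
is a percolation cluster meeting `γ` and `∂₀Q`.  The latter has an open crossing of the annulus
`A(Q(1,1), δ, d₀)`, which by the RSW estimate (1.2) has probability at most `Δ₁(δ, d)` … If
`d = d₁`, a similar argument shows the symmetric difference between the event of a closed crossing
from `∂₁Q` to `∂₃Q` in `[Q]` and the corresponding event in `Q'` is bounded by `Δ₁(δ, d₁)`.
Duality shows that the latter symmetric difference is the same as `⊞_Q Δ ⊞_{Q'}`."

This file proves case (1) **end to end for critical bond percolation on `δℤ²`**
(`real_symmDiff_crossedEvent_le_of_isPerturbationOne`): there are `α, C, c > 0` with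
`μ_η(⊞_Q Δ ⊞_{Q'}) ≤ (C ρ / d(Q))^α` whenever `Q.IsPerturbationOne Q' ρ`, `0 < ρ ≤ c · d(Q)` and
`0 < η < ρ`.  The topological heart, left implicit in the source ("a cluster meeting `γ`"), is
`Quad.exists_mem_of_path_to_arc`: with the boundary loop `L` of `QuadCrossingFourPoint.lean`
(`∂₂Q ∪ ∂₃Q = L([1/4, 3/4])`, the two corners being `L(1/2)` and `L(t')`,
`QuadCrossingCaseOneTopology.lean`), any path in `[Q]` from `∂₀Q ∪ ∂₁Q` to a point `L(t_b)` with
`t_b` between the two corner parameters meets `γ` — by the separation hypothesis applied to the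
two boundary arcs from the corners to `L(t_b)` followed by the path reversed, and the four-point
crossing lemma.  Consequently (`Quad.exists_arm_of_path`) a crossing of exactly one of `Q, Q'`
(open, `∂₀ → ∂₂`, when `d = d₀`; dual, `∂₁ → ∂₃`, via the exact duality of
`QuadCrossingDuality.lean`, when `d = d₁`) passes through `γ ⊆ B̄(γ(0), ρ)` and has diameter
`≥ d - ρ` (`Quad.sideDist_sub_le_diam`, because `γ` itself meets `∂₂Q` and `∂₃Q`), hence crosses
the annulus `A(γ(0); ρ, d/2 - 2ρ)`; the RSW bounds `annulusOpenCrossing_half_le_holds` /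
self-duality finish.  (The annulus is centred at `γ(0)` rather than at `Q(1,1)`: `γ` need not be
close to the corner.)  Everything is proved; no named fact is introduced.

## References

* O. Schramm, S. Smirnov, Ann. Probab. 39 (2011) 1768–1814, arXiv:1101.5820, proof of Lemma 6.1,
  case (1), p. 22. [SchrammSmirnov2011]
* G. Grimmett, *Percolation*, 2nd ed. (1999), §11.8 (RSW annulus bounds). [GrimmettPercolation1999]
-/

noncomputable section

open scoped unitInterval
open Set Filter Metric Function MeasureTheory
open _root_.Topology
open Literature.Probability.LatticeModels

namespace Literature.Probability.Percolation

namespace QuadCrossing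

variable {D : Set ℂ}

/-- The open annulus-crossing event grows with the inner radius. [folklore] -/
private theorem annulusOpenCrossing_mono_left_aux (x : ℂ) (δ : ℝ) {r r' : ℝ} (h : r ≤ r') (R : ℝ) :
    annulusOpenCrossing x δ r R ⊆ annulusOpenCrossing x δ r' R := fun ω hω => by
  obtain ⟨u, hu, w, hw, hconn⟩ := mem_annulusOpenCrossing_iff.1 hω
  exact mem_annulusOpenCrossing_iff.2 ⟨u, hu.trans h, w, hw, hconn⟩

/-- The closed annulus-crossing event grows with the inner radius. [folklore] -/
private theorem annulusDualCrossing_mono_left_aux (x : ℂ) (δ : ℝ) {r r' : ℝ} (h : r ≤ r') (R : ℝ) :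
    annulusDualCrossing x δ r R ⊆ annulusDualCrossing x δ r' R :=
  fun _ hω => annulusOpenCrossing_mono_left_aux x δ h R hω

namespace Quad

variable {Q Q' : Quad D}

/-! ### A path to the differing boundary arc meets the cut `γ` -/

/-- **Paths to the arc between the two corners meet the cut.**  Let `L` be the boundary loop of
`Q` (`∂₁Q = L[0,1/4]`, `∂₀Q = L[3/4,1]`, four-point property), `C ⊆ [Q]` a continuum, and
`1/4 ≤ m ≤ M < 3/4` parameters such that every path in `[Q]` from `L m` or from `L M` to
`∂₀Q ∪ ∂₁Q` meets `C`.  Then every path in `[Q]` from `∂₀Q ∪ ∂₁Q` to a point `L t_b`,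
`t_b ∈ [m, M]`, meets `C`: otherwise `C` meets the boundary arcs `L[m, t_b)` and `L(t_b, M]`, and
the four-point crossing lemma forces the path through `C`.
[cite: SchrammSmirnov2011, proof of Lemma 6.1, case (1)] -/
theorem exists_mem_of_path_to_arc {L : ℝ → ℂ} (hLc : Continuous L) (hL10 : L 1 = L 0)
    (hLr : range L = frontier Q.carrier)
    (hL1 : L '' Icc 0 (1 / 4) = Q.side 1) (hL0 : L '' Icc (3 / 4) 1 = Q.side 0)
    (h4 : ∀ t₁ t₂ t₃ t₄ : ℝ, 0 ≤ t₁ → t₁ < t₂ → t₂ < t₃ → t₃ < t₄ → t₄ < 1 →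
        (∀ C ⊆ Q.carrier, IsCompact C → IsPreconnected C → L t₁ ∈ C → L t₃ ∈ C →
          ∀ K : ℝ → ℂ, ContinuousOn K (Icc 0 1) → MapsTo K (Icc 0 1) Q.carrier →
            K 0 = L t₂ → K 1 = L t₄ → ∃ s ∈ Icc (0 : ℝ) 1, K s ∈ C) ∧
        (∀ C ⊆ Q.carrier, IsCompact C → IsPreconnected C → L t₂ ∈ C → L t₄ ∈ C →
          ∀ K : ℝ → ℂ, ContinuousOn K (Icc 0 1) → MapsTo K (Icc 0 1) Q.carrier →
            K 0 = L t₁ → K 1 = L t₃ → ∃ s ∈ Icc (0 : ℝ) 1, K s ∈ C))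
    {C : Set ℂ} (hCsub : C ⊆ Q.carrier) (hCc : IsCompact C) (hCpc : IsPreconnected C)
    {m M : ℝ} (hm : 1 / 4 ≤ m) (hM : M < 3 / 4)
    (hsepm : ∀ y ∈ Q.side 0 ∪ Q.side 1, ∀ β : Path (L m) y, range β ⊆ Q.carrier →
      (range β ∩ C).Nonempty)
    (hsepM : ∀ y ∈ Q.side 0 ∪ Q.side 1, ∀ β : Path (L M) y, range β ⊆ Q.carrier →
      (range β ∩ C).Nonempty)
    {K : ℝ → ℂ} (hK : ContinuousOn K (Icc 0 1)) (hKQ : MapsTo K (Icc 0 1) Q.carrier)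
    (hK0 : K 0 ∈ Q.side 0 ∪ Q.side 1) {tb : ℝ} (htb : tb ∈ Icc m M) (hK1 : K 1 = L tb) :
    ∃ s ∈ Icc (0 : ℝ) 1, K s ∈ C := by
  by_contra hcon
  push Not at hcon
  have hLQ : ∀ u, L u ∈ Q.carrier := fun u =>
    Q.isCompact_carrier.isClosed.frontier_subset (hLr ▸ mem_range_self u)
  have hKimQ : K '' Icc 0 1 ⊆ Q.carrier := fun _ ⟨s, hs, e⟩ => e ▸ hKQ hs
  -- the reversed path `K⁻` as a `Path`
  have hKr : ContinuousOn (fun s : ℝ => K (1 - s)) (Icc 0 1) :=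
    hK.comp (by fun_prop) fun s hs => ⟨by linarith [hs.2], by linarith [hs.1]⟩
  obtain ⟨p, hp⟩ := exists_path_of_continuousOn hKr
  have hprange : range p ⊆ K '' Icc 0 1 := by
    rintro _ ⟨t, rfl⟩
    exact ⟨1 - t, ⟨by linarith [t.2.2], by linarith [t.2.1]⟩, (hp t).symm⟩
  -- from a corner `L v`: the boundary arc `L[v ↝ tb]` followed by `K⁻` meets `C` on the arc
  have key : ∀ v : ℝ, (∀ y ∈ Q.side 0 ∪ Q.side 1, ∀ β : Path (L v) y, range β ⊆ Q.carrier →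
      (range β ∩ C).Nonempty) →
      ∃ s : ℝ, s ∈ Icc (0 : ℝ) 1 ∧ L (v + s * (tb - v)) ∈ C ∧ v + s * (tb - v) ≠ tb := by
    intro v hsep
    let arc : Path (L v) (L tb) :=
      ⟨⟨fun s => L (v + (s : ℝ) * (tb - v)), by fun_prop⟩, by simp, by simp⟩
    let p' : Path (L tb) (K 0) :=
      p.cast (by simp only [sub_zero]; exact hK1.symm) (by simp only [sub_self])
    have hp'r : range p' ⊆ K '' Icc 0 1 := by rw [Path.cast_coe]; exact hprange
    obtain ⟨z, hzβ, hzC⟩ := hsep (K 0) hK0 (arc.trans p') (by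
      rw [Path.trans_range]
      refine union_subset ?_ (hp'r.trans hKimQ)
      rintro _ ⟨s, rfl⟩
      exact hLQ _)
    rw [Path.trans_range] at hzβ
    rcases hzβ with ⟨s, rfl⟩ | hz
    · change L (v + (s : ℝ) * (tb - v)) ∈ C at hzC
      refine ⟨s, ⟨s.2.1, s.2.2⟩, hzC, fun h => ?_⟩
      refine hcon 1 (right_mem_Icc.2 zero_le_one) ?_
      rw [hK1, ← h]
      exact hzC
    · obtain ⟨s, hs, hsz⟩ := hp'r hz
      exact (hcon s hs (hsz ▸ hzC)).elim
  -- `u₂ ∈ (tb, M]` and `u₁ ∈ [m, tb)` with `L u₁, L u₂ ∈ C`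
  obtain ⟨s₂, hs₂, hC₂, hne₂⟩ := key M hsepM
  obtain ⟨s₁, hs₁, hC₁, hne₁⟩ := key m hsepm
  set u₂ : ℝ := M + s₂ * (tb - M) with hu₂
  set u₁ : ℝ := m + s₁ * (tb - m) with hu₁
  have hu₂M : u₂ ≤ M := by
    have : 0 ≤ s₂ * (M - tb) := mul_nonneg hs₂.1 (by linarith [htb.2])
    rw [hu₂]; nlinarith
  have htbu₂ : tb < u₂ := by
    rcases (show tb ≤ u₂ by
      have : 0 ≤ (1 - s₂) * (M - tb) := mul_nonneg (by linarith [hs₂.2]) (by linarith [htb.2])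
      rw [hu₂]; nlinarith).eq_or_lt with h | h
    · exact absurd h.symm hne₂
    · exact h
  have hmu₁ : m ≤ u₁ := by
    have : 0 ≤ s₁ * (tb - m) := mul_nonneg hs₁.1 (by linarith [htb.1])
    rw [hu₁]; linarith
  have hu₁tb : u₁ < tb := by
    rcases (show u₁ ≤ tb by
      have : 0 ≤ (1 - s₁) * (tb - m) := mul_nonneg (by linarith [hs₁.2]) (by linarith [htb.1])
      rw [hu₁]; nlinarith).eq_or_lt with h | h
    · exact absurd h hne₁
    · exact h
  -- the starting point on `∂₀Q ∪ ∂₁Q`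
  rcases hK0 with hk | hk
  · rw [← hL0] at hk
    obtain ⟨uk, huk, hke⟩ := hk
    rcases huk.2.eq_or_lt with rfl | huk1
    · -- `K 0 = L 1 = L 0`: points `0 < u₁ < tb < u₂`
      obtain ⟨s, hs, hsC⟩ := (h4 0 u₁ tb u₂ le_rfl (by linarith) hu₁tb htbu₂ (by linarith)).2
        C hCsub hCc hCpc hC₁ hC₂ K hK hKQ (by rw [← hke, hL10]) hK1
      exact hcon s hs hsC
    · -- `uk ∈ [3/4, 1)`: points `u₁ < tb < u₂ < uk`, the path reversed
      obtain ⟨s, hs, hsC⟩ := (h4 u₁ tb u₂ uk (by linarith) hu₁tb htbu₂ (by linarith [huk.1]) huk1).1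
        C hCsub hCc hCpc hC₁ hC₂ (fun s => K (1 - s)) hKr
        (fun s hs => hKQ ⟨by linarith [hs.2], by linarith [hs.1]⟩)
        (by simp only [sub_zero]; exact hK1) (by simp only [sub_self]; exact hke.symm)
      exact hcon (1 - s) ⟨by linarith [hs.2], by linarith [hs.1]⟩ hsC
  · rw [← hL1] at hk
    obtain ⟨uk, huk, hke⟩ := hk
    rcases (show uk ≤ u₁ by linarith [huk.2]).eq_or_lt with h | h
    · -- `K 0 = L u₁ ∈ C`
      exact hcon 0 (left_mem_Icc.2 zero_le_one) (by rw [← hke, h]; exact hC₁)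
    · -- points `uk < u₁ < tb < u₂`
      obtain ⟨s, hs, hsC⟩ := (h4 uk u₁ tb u₂ huk.1 h hu₁tb htbu₂ (by linarith)).2
        C hCsub hCc hCpc hC₁ hC₂ K hK hKQ hke.symm hK1
      exact hcon s hs hsC

/-! ### The cut meets `∂₂Q` and `∂₃Q`; diameter of paths through the cut -/

/-- If every path from `Q(1,1)` to `∂₀Q ∪ ∂₁Q` in `[Q]` meets `γ`, then `γ` meets `∂₂Q` (apply the
hypothesis to the side `∂₂Q` itself, run from `Q(1,1)` to `Q(1,0) ∈ ∂₁Q`).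
[cite: SchrammSmirnov2011, proof of Lemma 6.1, case (1)] -/
theorem nonempty_inter_side_two_of_sep (Q : Quad D) {a b : ℂ} {γ : Path a b}
    (hsep : ∀ y ∈ Q.side 0 ∪ Q.side 1, ∀ β : Path (Q (1, 1)) y, range β ⊆ Q.carrier →
      (range β ∩ range γ).Nonempty) :
    (range γ ∩ Q.side 2).Nonempty := by
  let β : Path (Q (1, 1)) (Q (1, 0)) :=
    ⟨⟨fun t => Q (1, σ t), Q.continuous_toFun.comp (continuous_const.prodMk unitInterval.continuous_symm)⟩,
      by simp, by simp⟩
  have hβ2 : range β ⊆ Q.side 2 := by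
    rintro _ ⟨t, rfl⟩
    exact ⟨(1, σ t), rfl, rfl⟩
  obtain ⟨z, hzβ, hzγ⟩ := hsep (Q (1, 0)) (Or.inr ⟨(1, 0), rfl, rfl⟩) β
    (hβ2.trans (Q.side_subset_carrier 2))
  exact ⟨z, hzγ, hβ2 hzβ⟩

/-- Likewise `γ` meets `∂₃Q` (the side `∂₃Q` runs from `Q(1,1)` to `Q(0,1) ∈ ∂₀Q`).
[cite: SchrammSmirnov2011, proof of Lemma 6.1, case (1)] -/
theorem nonempty_inter_side_three_of_sep (Q : Quad D) {a b : ℂ} {γ : Path a b}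
    (hsep : ∀ y ∈ Q.side 0 ∪ Q.side 1, ∀ β : Path (Q (1, 1)) y, range β ⊆ Q.carrier →
      (range β ∩ range γ).Nonempty) :
    (range γ ∩ Q.side 3).Nonempty := by
  let β : Path (Q (1, 1)) (Q (0, 1)) :=
    ⟨⟨fun t => Q (σ t, 1), Q.continuous_toFun.comp (unitInterval.continuous_symm.prodMk continuous_const)⟩,
      by simp, by simp⟩
  have hβ3 : range β ⊆ Q.side 3 := by
    rintro _ ⟨t, rfl⟩
    exact ⟨(σ t, 1), rfl, rfl⟩
  obtain ⟨z, hzβ, hzγ⟩ := hsep (Q (0, 1)) (Or.inl ⟨(0, 1), rfl, rfl⟩) β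
    (hβ3.trans (Q.side_subset_carrier 3))
  exact ⟨z, hzγ, hβ3 hzβ⟩

/-- **A path from `∂_jQ` through the cut has diameter `≥ d_j(Q) - ρ`**: following it up to the
cut and then the cut (diameter `≤ ρ`) to its point on `∂_{j+2}Q` gives a path from `∂_jQ` to
`∂_{j+2}Q`, of diameter `≥ d_j(Q)` by definition. [cite: SchrammSmirnov2011, proof of Lemma 6.1, case (1)] -/
theorem sideDist_sub_le_diam {j k : Fin 4} (hjk : j + 2 = k) {q : ℝ → ℂ}
    (hq : ContinuousOn q (Icc 0 1)) (hqQ : MapsTo q (Icc 0 1) Q.carrier) (hq0 : q 0 ∈ Q.side j)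
    {s : ℝ} (hs : s ∈ Icc (0 : ℝ) 1) {a b : ℂ} {γ : Path a b} (hγQ : range γ ⊆ Q.carrier)
    {ρ : ℝ} (hγd : Metric.diam (range γ) ≤ ρ) (hqs : q s ∈ range γ)
    (hγk : (range γ ∩ Q.side k).Nonempty) :
    Q.sideDist j - ρ ≤ Metric.diam (q '' Icc 0 1) := by
  obtain ⟨g₂, ⟨u₂, rfl⟩, hg₂⟩ := hγk
  obtain ⟨u, hu⟩ := hqs
  -- `q` on `[0, s]`, reparametrised, as a `Path`
  have hq1 : ContinuousOn (fun t : ℝ => q (s * t)) (Icc 0 1) :=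
    hq.comp (by fun_prop) fun t ht => ⟨mul_nonneg hs.1 ht.1, by nlinarith [hs.2, ht.2, hs.1, ht.1]⟩
  obtain ⟨p₁, hp₁⟩ := exists_path_of_continuousOn hq1
  have hp₁r : range p₁ ⊆ q '' Icc 0 1 := by
    rintro _ ⟨t, rfl⟩
    exact ⟨s * t, ⟨mul_nonneg hs.1 t.2.1, by nlinarith [hs.2, t.2.2, hs.1, t.2.1]⟩, (hp₁ t).symm⟩
  -- along `γ` from `γ u = q s` to `γ u₂ ∈ ∂_kQ`
  let p₂ : Path (γ u) (γ u₂) :=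
    ⟨⟨fun t => γ (projIcc 0 1 zero_le_one ((u : ℝ) + (t : ℝ) * (u₂ - u))),
      γ.continuous.comp (continuous_projIcc.comp (by fun_prop))⟩, by simp, by simp⟩
  have hp₂r : range p₂ ⊆ range γ := by
    rintro _ ⟨t, rfl⟩
    exact mem_range_self _
  let P : Path (q 0) (γ u₂) :=
    (p₁.cast (by simp only [mul_zero]) (by simp only [mul_one]; exact hu)).trans p₂
  have hPr : range P ⊆ q '' Icc 0 1 ∪ range γ := by
    rw [Path.trans_range, Path.cast_coe]
    exact union_subset_union hp₁r hp₂r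
  have hk : γ u₂ ∈ Q.side (j + 2) := by rw [hjk]; exact hg₂
  have hqim : q '' Icc 0 1 ⊆ Q.carrier := fun _ ⟨t, ht, e⟩ => e ▸ hqQ ht
  have hle := sideDist_le hq0 hk P (hPr.trans (union_subset hqim hγQ))
  have hbdd : Bornology.IsBounded (q '' Icc 0 1 ∪ range γ) :=
    ((isCompact_Icc.image_of_continuousOn hq).union (isCompact_range γ.continuous)).isBounded
  have hqs' : q s ∈ q '' Icc 0 1 := ⟨s, hs, rfl⟩
  have hqs'' : q s ∈ range γ := ⟨u, hu⟩
  calc Q.sideDist j - ρ ≤ Metric.diam (range P) - ρ := by linarith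
    _ ≤ Metric.diam (q '' Icc 0 1 ∪ range γ) - ρ := by
        linarith [Metric.diam_mono hPr hbdd]
    _ ≤ Metric.diam (q '' Icc 0 1) + dist (q s) (q s) + Metric.diam (range γ) - ρ := by
        linarith [Metric.diam_union hqs' hqs'']
    _ ≤ Metric.diam (q '' Icc 0 1) := by rw [dist_self]; linarith

/-! ### The arm of a differing crossing -/

/-- **The arm.**  In the setting of `exists_mem_of_path_to_arc` with `C = γ` a path of diameter
`≤ ρ` meeting `∂_{j+2}Q`, a path `K` in `[Q]` from `∂_jQ` (`j = 0` or `1`) to `L t_b`,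
`t_b ∈ [m, M]`, contains a sub-path running from `B̄(γ(0), ρ)` to distance `R = d_j(Q)/2 - 2ρ`
from `γ(0)` inside `B̄(γ(0), R)` (provided `ρ < R`): `K` meets `γ` and has diameter `≥ d_j - ρ`.
[cite: SchrammSmirnov2011, proof of Lemma 6.1, case (1)] -/
theorem exists_arm_of_path {L : ℝ → ℂ} (hLc : Continuous L) (hL10 : L 1 = L 0)
    (hLr : range L = frontier Q.carrier)
    (hL1 : L '' Icc 0 (1 / 4) = Q.side 1) (hL0 : L '' Icc (3 / 4) 1 = Q.side 0)
    (h4 : ∀ t₁ t₂ t₃ t₄ : ℝ, 0 ≤ t₁ → t₁ < t₂ → t₂ < t₃ → t₃ < t₄ → t₄ < 1 →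
        (∀ C ⊆ Q.carrier, IsCompact C → IsPreconnected C → L t₁ ∈ C → L t₃ ∈ C →
          ∀ K : ℝ → ℂ, ContinuousOn K (Icc 0 1) → MapsTo K (Icc 0 1) Q.carrier →
            K 0 = L t₂ → K 1 = L t₄ → ∃ s ∈ Icc (0 : ℝ) 1, K s ∈ C) ∧
        (∀ C ⊆ Q.carrier, IsCompact C → IsPreconnected C → L t₂ ∈ C → L t₄ ∈ C →
          ∀ K : ℝ → ℂ, ContinuousOn K (Icc 0 1) → MapsTo K (Icc 0 1) Q.carrier →
            K 0 = L t₁ → K 1 = L t₃ → ∃ s ∈ Icc (0 : ℝ) 1, K s ∈ C))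
    {a b : ℂ} {γ : Path a b} (hγQ : range γ ⊆ Q.carrier) {ρ : ℝ}
    (hγd : Metric.diam (range γ) ≤ ρ)
    {m M : ℝ} (hm : 1 / 4 ≤ m) (hM : M < 3 / 4)
    (hsepm : ∀ y ∈ Q.side 0 ∪ Q.side 1, ∀ β : Path (L m) y, range β ⊆ Q.carrier →
      (range β ∩ range γ).Nonempty)
    (hsepM : ∀ y ∈ Q.side 0 ∪ Q.side 1, ∀ β : Path (L M) y, range β ⊆ Q.carrier →
      (range β ∩ range γ).Nonempty)
    {j k : Fin 4} (hjk : j + 2 = k) (hj : Q.side j ⊆ Q.side 0 ∪ Q.side 1)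
    (hγk : (range γ ∩ Q.side k).Nonempty)
    {K : ℝ → ℂ} (hK : ContinuousOn K (Icc 0 1)) (hKQ : MapsTo K (Icc 0 1) Q.carrier)
    (hK0 : K 0 ∈ Q.side j) {tb : ℝ} (htb : tb ∈ Icc m M) (hK1 : K 1 = L tb)
    (hρ : 0 < ρ) (hρR : ρ < Q.sideDist j / 2 - 2 * ρ) :
    ∃ φ : ℝ → ℂ, ContinuousOn φ (Icc 0 1) ∧ (∀ t ∈ Icc (0 : ℝ) 1, φ t ∈ K '' Icc 0 1) ∧
      dist (φ 0) a ≤ ρ ∧ (∀ t ∈ Icc (0 : ℝ) 1, dist (φ t) a ≤ Q.sideDist j / 2 - 2 * ρ) ∧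
      Q.sideDist j / 2 - 2 * ρ ≤ dist (φ 1) a := by
  set R : ℝ := Q.sideDist j / 2 - 2 * ρ with hR
  -- `K` meets `γ`
  obtain ⟨s, hs, hsγ⟩ := exists_mem_of_path_to_arc hLc hL10 hLr hL1 hL0 h4 hγQ
    (isCompact_range γ.continuous) (isPreconnected_range γ.continuous) hm hM hsepm hsepM hK hKQ
    (hj hK0) htb hK1
  have hga : dist (K s) a ≤ ρ := by
    refine (dist_le_diam_of_mem (isCompact_range γ.continuous).isBounded hsγ ⟨0, γ.source⟩).trans hγd
  -- `K` has diameter `≥ d_j - ρ`, so some point is at distance `≥ (d_j - 2ρ)/2` from `K s`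
  have hdiam := sideDist_sub_le_diam hjk hK hKQ hK0 hs hγQ hγd hsγ hγk
  obtain ⟨t₁, ht₁, hfar⟩ : ∃ t₁ ∈ Icc (0 : ℝ) 1, (Q.sideDist j - 2 * ρ) / 2 ≤ dist (K t₁) (K s) := by
    by_contra h
    push Not at h
    have hle : Metric.diam (K '' Icc 0 1) ≤ Q.sideDist j - 2 * ρ := by
      refine Metric.diam_le_of_forall_dist_le (by linarith) ?_
      rintro _ ⟨x, hx, rfl⟩ _ ⟨y, hy, rfl⟩
      have hx' := h x hx
      have hy' := h y hy
      rw [dist_comm] at hy'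
      linarith [dist_triangle (K x) (K s) (K y)]
    linarith
  have hfar' : R ≤ dist (K t₁) a := by
    rw [hR]
    linarith [dist_triangle (K t₁) a (K s), dist_comm a (K s)]
  -- the sub-path from `K s` to `K t₁`, stopped at distance `R`
  set ψ : ℝ → ℂ := fun u => K (s + u * (t₁ - s)) with hψ
  have hmem : ∀ u ∈ Icc (0 : ℝ) 1, s + u * (t₁ - s) ∈ Icc (0 : ℝ) 1 := by
    intro u hu
    constructor
    · have h1 : 0 ≤ (1 - u) * s + u * t₁ := by nlinarith [hs.1, ht₁.1, hu.1, hu.2]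
      nlinarith
    · have h1 : (1 - u) * s + u * t₁ ≤ 1 := by nlinarith [hs.2, ht₁.2, hu.1, hu.2]
      nlinarith
  have hψc : ContinuousOn ψ (Icc 0 1) := hK.comp (by fun_prop) hmem
  have hψ0 : dist (ψ 0) a < R := by
    have : ψ 0 = K s := by simp [hψ]
    rw [this]; linarith
  have hψ1 : R ≤ dist (ψ 1) a := by
    have : ψ 1 = K t₁ := by simp [hψ]
    rwa [this]
  obtain ⟨φ, hφc, hφ0, hφim, hφR, hφ1⟩ := exists_restrict_until_dist_ge hψc hψ0 hψ1
  refine ⟨φ, hφc, fun t ht => ?_, ?_, hφR, hφ1⟩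
  · obtain ⟨u, hu, hue⟩ := hφim t ht
    exact ⟨s + u * (t₁ - s), hmem u hu, hue⟩
  · rw [hφ0]
    have : ψ 0 = K s := by simp [hψ]
    rw [this]; exact hga

end Quad

/-! ### Case (1) of Lemma 6.1 for bond percolation on `δℤ²` -/

/-- **The two event inclusions of case (1).**  Under condition (1) with cut `γ` of diameter `≤ ρ`
(`0 < ρ`), for the bond configuration of mesh `δ' > 0`: if `ρ < d₀/2 - 2ρ`, the symmetric
difference of the discrete crossing events of `Q` and `Q'` is contained in the open crossing of
`A(γ(0); ρ + δ', d₀/2 - 2ρ - δ')`; if `ρ + 2δ' ≤ d₁/2 - 2ρ`, it is contained in the closed crossing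
of `A(γ(0); ρ + 2δ', d₁/2 - 2ρ - 2δ')` (exact duality, `QuadCrossingDuality.lean`).
[cite: SchrammSmirnov2011, proof of Lemma 6.1, case (1), p. 22] -/
theorem symmDiff_subset_annulusCrossing_of_isPerturbationOne {Q Q' : Quad D} {ρ : ℝ} (hρ : 0 < ρ)
    (hP : Q.IsPerturbationOne Q' ρ) {δ' : ℝ} (hδ' : 0 < δ') :
    ∃ a : ℂ,
      (ρ < Q.sideDist 0 / 2 - 2 * ρ →
        symmDiff {ω | Q ∈ z2QuadConfig D δ' ω} {ω | Q' ∈ z2QuadConfig D δ' ω} ⊆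
          annulusOpenCrossing a δ' (ρ + δ') (Q.sideDist 0 / 2 - 2 * ρ - δ')) ∧
      (ρ < Q.sideDist 1 / 2 - 2 * ρ → ρ + 2 * δ' ≤ Q.sideDist 1 / 2 - 2 * ρ →
        symmDiff {ω | Q ∈ z2QuadConfig D δ' ω} {ω | Q' ∈ z2QuadConfig D δ' ω} ⊆
          annulusDualCrossing a δ' (ρ + 2 * δ') (Q.sideDist 1 / 2 - 2 * ρ - 2 * δ')) := by
  obtain ⟨hcar, h0, h1, a, b, γ, hγQ, hγd, hsep⟩ := hP
  refine ⟨a, ?_, ?_⟩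
  all_goals
    -- the boundary loop and the two corner parameters
    obtain ⟨L, hLc, hLp, hLinj, hLr, hL1, hL2, hL3, hL0, h4⟩ := Q.exists_boundaryLoop
    obtain ⟨t', ht', hc't, hQ'2, hQ'3⟩ :=
      Quad.exists_param_corner hLc hLp hLinj hLr hL1 hL2 hL3 hL0 hcar h0 h1
    have hL10 : L 1 = L 0 := by simpa using hLp 0
    have hLhalf : L (1 / 2) = Q (1, 1) := by
      have : L (1 / 2) ∈ Q.side 2 ∩ Q.side 3 :=
        ⟨hL2 ▸ ⟨1 / 2, ⟨by norm_num, le_rfl⟩, rfl⟩, hL3 ▸ ⟨1 / 2, ⟨le_rfl, by norm_num⟩, rfl⟩⟩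
      rw [(Q.side_inter_side).2.2.1] at this
      exact this
    obtain ⟨m, hm⟩ : ∃ m : ℝ, m = min (1 / 2) t' := ⟨_, rfl⟩
    obtain ⟨M, hM⟩ : ∃ M : ℝ, M = max (1 / 2) t' := ⟨_, rfl⟩
    have hm4 : 1 / 4 ≤ m := by rw [hm]; exact le_min (by norm_num) ht'.1.le
    have hM4 : M < 3 / 4 := by rw [hM]; exact max_lt (by norm_num) ht'.2
    have hm2 : m ≤ 1 / 2 := by rw [hm]; exact min_le_left _ _
    have hmt : m ≤ t' := by rw [hm]; exact min_le_right _ _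
    have hM2 : 1 / 2 ≤ M := by rw [hM]; exact le_max_left _ _
    have hMt : t' ≤ M := by rw [hM]; exact le_max_right _ _
    have hcorner : ∀ v : ℝ, (v = 1 / 2 ∨ v = t') → L v ∈ ({Q (1, 1), Q' (1, 1)} : Set ℂ) := by
      rintro v (rfl | rfl)
      · rw [hLhalf]; exact mem_insert _ _
      · rw [← hc't]; exact mem_insert_of_mem _ (mem_singleton _)
    have hmv : m = 1 / 2 ∨ m = t' := by
      rcases le_total (1 / 2 : ℝ) t' with h | h
      · exact Or.inl (by rw [hm]; exact min_eq_left h)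
      · exact Or.inr (by rw [hm]; exact min_eq_right h)
    have hMv : M = 1 / 2 ∨ M = t' := by
      rcases le_total (1 / 2 : ℝ) t' with h | h
      · exact Or.inr (by rw [hM]; exact max_eq_right h)
      · exact Or.inl (by rw [hM]; exact max_eq_left h)
    have hsepm : ∀ y ∈ Q.side 0 ∪ Q.side 1, ∀ β : Path (L m) y, range β ⊆ Q.carrier →
        (range β ∩ range γ).Nonempty := fun y hy β hβ => hsep (L m) (hcorner m hmv) y hy β hβ
    have hsepM : ∀ y ∈ Q.side 0 ∪ Q.side 1, ∀ β : Path (L M) y, range β ⊆ Q.carrier →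
        (range β ∩ range γ).Nonempty := fun y hy β hβ => hsep (L M) (hcorner M hMv) y hy β hβ
    have hsepc : ∀ y ∈ Q.side 0 ∪ Q.side 1, ∀ β : Path (Q (1, 1)) y, range β ⊆ Q.carrier →
        (range β ∩ range γ).Nonempty := fun y hy β hβ => hsep (Q (1, 1)) (mem_insert _ _) y hy β hβ
  · -- the open inclusion
    intro hρR ω hω
    have hγ2 := Q.nonempty_inter_side_two_of_sep hsepc
    -- an open continuum in `[Q]` from `∂₀Q` to `L tb`, `tb ∈ [m, M]`
    obtain ⟨K, hKc, hKconn, hKQ, k, hkK, hk0, bb, hbbK, tb, htb, hbb, hKO⟩ :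
        ∃ K : Set ℂ, IsCompact K ∧ IsConnected K ∧ K ⊆ Q.carrier ∧ ∃ k ∈ K, k ∈ Q.side 0 ∧
          ∃ bb ∈ K, ∃ tb ∈ Icc m M, L tb = bb ∧ K ⊆ openEdgeUnion δ' ω := by
      rcases (Set.mem_symmDiff).1 hω with ⟨hωA, hωB⟩ | ⟨hωB, hωA⟩
      · rw [mem_setOf_eq, mem_z2QuadConfig_iff_exists_isCrossing hδ'] at hωA
        obtain ⟨K, ⟨hKc, hKconn, hKQ, ⟨k, hkK, hk0⟩, ⟨bb, hbbK, hbb2⟩⟩, hKO⟩ := hωA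
        have hbb2' := hbb2
        rw [← hL2] at hbb2'
        obtain ⟨tb, htb, rfl⟩ := hbb2'
        refine ⟨K, hKc, hKconn, hKQ, k, hkK, hk0, L tb, hbbK, tb, ⟨?_, htb.2.trans hM2⟩,
          rfl, hKO⟩
        -- `tb ≤ t'` would make `K` a crossing of `Q'`
        by_contra hlt
        push Not at hlt
        have htb' : tb ≤ t' := by linarith [hmt]
        apply hωB
        rw [mem_setOf_eq, mem_z2QuadConfig_iff_exists_isCrossing hδ']
        refine ⟨K, ⟨hKc, hKconn, by rw [hcar]; exact hKQ, ⟨k, hkK, by rw [h0]; exact hk0⟩,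
          ⟨L tb, hbbK, ?_⟩⟩, hKO⟩
        rw [hQ'2]; exact ⟨tb, ⟨htb.1, htb'⟩, rfl⟩
      · rw [mem_setOf_eq, mem_z2QuadConfig_iff_exists_isCrossing hδ'] at hωB
        obtain ⟨K, ⟨hKc, hKconn, hKQ, ⟨k, hkK, hk0⟩, ⟨bb, hbbK, hbb2⟩⟩, hKO⟩ := hωB
        have hbb2' := hbb2
        rw [hQ'2] at hbb2'
        obtain ⟨tb, htb, rfl⟩ := hbb2'
        have hKQ' : K ⊆ Q.carrier := by rw [← hcar]; exact hKQ
        have hk0' : k ∈ Q.side 0 := by rw [← h0]; exact hk0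
        refine ⟨K, hKc, hKconn, hKQ', k, hkK, hk0', L tb, hbbK, tb,
          ⟨?_, htb.2.trans hMt⟩, rfl, hKO⟩
        -- `tb ≤ 1/2` would make `K` a crossing of `Q`
        by_contra hlt
        push Not at hlt
        have htb' : tb ≤ 1 / 2 := by linarith [hm2]
        apply hωA
        rw [mem_setOf_eq, mem_z2QuadConfig_iff_exists_isCrossing hδ']
        refine ⟨K, ⟨hKc, hKconn, hKQ', ⟨k, hkK, hk0'⟩, ⟨L tb, hbbK, ?_⟩⟩, hKO⟩
        rw [← hL2]; exact ⟨tb, ⟨htb.1, htb'⟩, rfl⟩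
    -- a path inside the open edges from `k` to `bb`
    obtain ⟨π, hπ⟩ := joinedIn_inter_openEdgeUnion_of_isConnected hδ' hKc hKconn hKO hKQ hkK hbbK
    have hKfc : ContinuousOn (fun t : ℝ => π.extend t) (Icc 0 1) := π.continuous_extend.continuousOn
    have hKfmem : ∀ t ∈ Icc (0 : ℝ) 1, π.extend t ∈ Q.carrier ∩ openEdgeUnion δ' ω := by
      intro t ht
      rw [π.extend_apply ht]
      exact hπ _
    have hKfQ : MapsTo (fun t : ℝ => π.extend t) (Icc 0 1) Q.carrier := fun t ht => (hKfmem t ht).1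
    have hKf0 : (fun t : ℝ => π.extend t) 0 ∈ Q.side 0 := by
      show π.extend 0 ∈ _
      rw [Path.extend_zero]; exact hk0
    have hKf1 : (fun t : ℝ => π.extend t) 1 = L tb := by
      show π.extend 1 = _
      rw [Path.extend_one]; exact hbb.symm
    obtain ⟨φ, hφc, hφim, hφ0, hφR, hφ1⟩ := Quad.exists_arm_of_path hLc hL10 hLr hL1 hL0 h4 hγQ hγd
      hm4 hM4 hsepm hsepM (j := 0) (k := 2) (by decide) (fun z hz => Or.inl hz) hγ2 hKfc hKfQ hKf0
      htb hKf1 hρ hρR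
    have hφO : ∀ t ∈ Icc (0 : ℝ) 1, φ t ∈ openEdgeUnion δ' ω := by
      intro t ht
      obtain ⟨u, hu, hue⟩ := hφim t ht
      rw [← hue]
      exact (hKfmem u hu).2
    exact mem_annulusOpenCrossing_of_path hδ' a hφc hφO hφ0 hφR hφ1
  · -- the dual inclusion
    intro hρR hrR ω hω
    have hγ3 := Q.nonempty_inter_side_three_of_sep hsepc
    -- a dual path in `[Q]` from `∂₁Q` to `L tb`, `tb ∈ [m, M]`
    obtain ⟨β, hβc, hβQ, hβ0, tb, htb, hβ1, hβO⟩ :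
        ∃ β : ℝ → ℂ, ContinuousOn β (Icc 0 1) ∧ MapsTo β (Icc 0 1) Q.carrier ∧ β 0 ∈ Q.side 1 ∧
          ∃ tb ∈ Icc m M, β 1 = L tb ∧ ∀ t ∈ Icc (0 : ℝ) 1, β t ∉ openEdgeUnion δ' ω := by
      rcases (Set.mem_symmDiff).1 hω with ⟨hωA, hωB⟩ | ⟨hωB, hωA⟩
      · -- `ω ∉ B`: a dual path of `Q'`; it is not one of `Q` since `ω ∈ A`
        rw [mem_setOf_eq, mem_z2QuadConfig_iff_exists_isCrossing hδ',
          Q'.not_exists_isCrossing_iff_exists_path_avoiding hδ'] at hωB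
        obtain ⟨β, hβc, hβQ, hβ0, hβ1, hβO⟩ := hωB
        have hβQ' : MapsTo β (Icc 0 1) Q.carrier := by rw [← hcar]; exact hβQ
        have hβ0' : β 0 ∈ Q.side 1 := by rw [← h1]; exact hβ0
        have hβ1' := hβ1
        rw [hQ'3] at hβ1'
        obtain ⟨tb, htb, htbe⟩ := hβ1'
        refine ⟨β, hβc, hβQ', hβ0', tb, ⟨hmt.trans htb.1, ?_⟩, htbe.symm,
          fun t ht => (hβO t ht).1⟩
        -- `1/2 ≤ tb` would make `β` a dual path of `Q`
        by_contra hlt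
        push Not at hlt
        have htb' : 1 / 2 ≤ tb := by linarith [hM2]
        have hωA' := hωA
        rw [mem_setOf_eq, mem_z2QuadConfig_iff_exists_isCrossing hδ'] at hωA'
        refine Q.not_exists_isCrossing_of_path_avoiding hβc hβQ' hβ0' ?_
          (fun t ht => (hβO t ht).1) hωA'
        rw [← hL3, ← htbe]
        exact ⟨tb, ⟨htb', htb.2⟩, rfl⟩
      · -- `ω ∉ A`: a dual path of `Q`; it is not one of `Q'` since `ω ∈ B`
        rw [mem_setOf_eq, mem_z2QuadConfig_iff_exists_isCrossing hδ',
          Q.not_exists_isCrossing_iff_exists_path_avoiding hδ'] at hωA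
        obtain ⟨β, hβc, hβQ, hβ0, hβ1, hβO⟩ := hωA
        have hβ1' := hβ1
        rw [← hL3] at hβ1'
        obtain ⟨tb, htb, htbe⟩ := hβ1'
        refine ⟨β, hβc, hβQ, hβ0, tb, ⟨hm2.trans htb.1, ?_⟩, htbe.symm, fun t ht => (hβO t ht).1⟩
        -- `t' ≤ tb` would make `β` a dual path of `Q'`
        by_contra hlt
        push Not at hlt
        have htb' : t' ≤ tb := by linarith [hMt]
        have hωB' := hωB
        rw [mem_setOf_eq, mem_z2QuadConfig_iff_exists_isCrossing hδ'] at hωB'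
        refine Q'.not_exists_isCrossing_of_path_avoiding hβc (by rw [hcar]; exact hβQ)
          (by rw [h1]; exact hβ0) ?_ (fun t ht => (hβO t ht).1) hωB'
        rw [hQ'3, ← htbe]
        exact ⟨tb, ⟨htb', htb.2⟩, rfl⟩
    obtain ⟨φ, hφc, hφim, hφ0, hφR, hφ1⟩ := Quad.exists_arm_of_path hLc hL10 hLr hL1 hL0 h4 hγQ hγd
      hm4 hM4 hsepm hsepM (j := 1) (k := 3) (by decide) (fun z hz => Or.inr hz) hγ3 hβc hβQ hβ0
      htb hβ1 hρ hρR
    have hφO : ∀ t ∈ Icc (0 : ℝ) 1, φ t ∉ openEdgeUnion δ' ω := by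
      intro t ht
      obtain ⟨u, hu, hue⟩ := hφim t ht
      rw [← hue]
      exact hβO u hu
    exact mem_annulusDualCrossing_of_path hδ' a hφc hφO hφ0 hφR hφ1 hrR

/-- **Lemma 6.1, case (1)** (Schramm–Smirnov), for critical bond percolation on `δℤ²`: there are
`α, C, c > 0` such that whenever `Q.IsPerturbationOne Q' ρ` and `0 < ρ ≤ c · d(Q)`, then for every
mesh `0 < η < ρ`, `μ_η(⊞_Q Δ ⊞_{Q'}) ≤ (C ρ / d(Q))^α`.  Proof: a configuration in the symmetric
difference has an open crossing of one quad landing on the boundary arc between the two corners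
(case `d = d₀`), or — by exact duality — a dual path from `∂₁` to the arc between the corners on
the `∂₃` side (case `d = d₁`); either meets the cut `γ` and has diameter `≥ d - ρ`, so crosses the
annulus `A(γ(0); ρ + 2δ', d/2 - 2ρ - 2δ')` (`δ' = η√2`); RSW.
[cite: SchrammSmirnov2011, proof of Lemma 6.1, case (1), p. 22] -/
theorem real_symmDiff_crossedEvent_le_of_isPerturbationOne :
    ∃ α C c : ℝ, 0 < α ∧ 0 < C ∧ 0 < c ∧
      ∀ (D : Set ℂ) (Q Q' : Quad D) (ρ : ℝ), 0 < ρ → ρ ≤ c * Q.sizeParam →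
        Q.IsPerturbationOne Q' ρ →
          ∀ η : ℝ, 0 < η → η < ρ →
            (squareCrossingLaw D η : Measure (QuadConfig D)).real
                (symmDiff (QuadConfig.crossedEvent Q) (QuadConfig.crossedEvent Q')) ≤
              (C * ρ / Q.sizeParam) ^ α := by
  obtain ⟨α, c₀, hα, hc₀, hRSW⟩ := annulusOpenCrossing_half_le_holds
  -- the closed-crossing bound with the same constants, by self-duality
  have hRSWd : ∀ (x : ℂ) (δ r R : ℝ), 0 < δ → c₀ * δ ≤ r → 2 * r ≤ R →
      (bondPercolation (zdGraph 2) half).real (annulusDualCrossing x δ r R) ≤ (r / R) ^ α := by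
    intro x δ r R hδ hr hR
    refine le_trans ?_ (hRSW x δ r R hδ hr hR)
    have hle : bondPercolation (zdGraph 2) half (annulusDualCrossing x δ r R) ≤
        bondPercolation (zdGraph 2) half (annulusOpenCrossing x δ r R) := by
      calc bondPercolation (zdGraph 2) half (annulusDualCrossing x δ r R)
          ≤ (bondPercolation (zdGraph 2) half).map dualConfig (annulusOpenCrossing x δ r R) :=
            Measure.le_map_apply measurable_dualConfig.aemeasurable _
        _ = bondPercolation (zdGraph 2) half (annulusOpenCrossing x δ r R) := by
            rw [bondPercolation_map_dualConfig_holds half,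
              show unitInterval.symm half = half from Subtype.ext (by simp [half]; norm_num)]
    simp only [measureReal_def]
    exact ENNReal.toReal_mono (measure_ne_top _ _) hle
  obtain ⟨C₁, hC₁⟩ : ∃ C₁ : ℝ, C₁ = 5 + 2 * c₀ := ⟨_, rfl⟩
  have hC₁pos : 0 < C₁ := by rw [hC₁]; linarith
  have hC₁5 : (5 : ℝ) ≤ C₁ := by rw [hC₁]; linarith [hc₀.le]
  refine ⟨α, 16 * C₁, 1 / (16 * (C₁ + 1)), hα, by positivity, by positivity, ?_⟩
  intro D Q Q' ρ hρ hρc hP η hη hηρ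
  obtain ⟨d, hd⟩ : ∃ d : ℝ, d = Q.sizeParam := ⟨_, rfl⟩
  rw [← hd] at hρc ⊢
  have hdpos : 0 < d := by rw [hd]; exact Q.sizeParam_pos
  have hρd : 16 * (C₁ + 1) * ρ ≤ d := by
    have := hρc
    rw [div_mul_eq_mul_div, one_mul, le_div_iff₀ (by positivity)] at this
    linarith
  have hCρ : 0 ≤ C₁ * ρ := by positivity
  have hρd' : 16 * (C₁ * ρ) + 16 * ρ ≤ d := by
    linarith [hρd, show 16 * (C₁ + 1) * ρ = 16 * (C₁ * ρ) + 16 * ρ by ring]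
  have hρ96 : 96 * ρ ≤ d := by nlinarith [mul_nonneg (sub_nonneg.2 hC₁5) hρ.le]
  -- the mesh `δ' = η √2 < 2ρ`
  obtain ⟨δ', hδ'⟩ : ∃ δ' : ℝ, δ' = η * Real.sqrt 2 := ⟨_, rfl⟩
  have hδ'pos : 0 < δ' := by rw [hδ']; exact mul_pos hη (Real.sqrt_pos.2 (by norm_num))
  have hsqrt2 : Real.sqrt 2 < 2 := by
    rw [show (2 : ℝ) = Real.sqrt 4 by
      rw [show (4 : ℝ) = 2 ^ 2 by norm_num, Real.sqrt_sq (by norm_num)]]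
    exact Real.sqrt_lt_sqrt (by norm_num) (by norm_num)
  have hδ'ρ : δ' < 2 * ρ := by
    calc δ' = η * Real.sqrt 2 := hδ'
      _ < ρ * 2 := mul_lt_mul'' hηρ hsqrt2 hη.le (Real.sqrt_nonneg _)
      _ = 2 * ρ := by ring
  -- Step 1: reduce to the bond configuration of mesh `δ'`
  refine (real_squareCrossingLaw_symmDiff_le D η Q Q').trans ?_
  rw [← hδ']
  obtain ⟨a, hopen, hdual⟩ := symmDiff_subset_annulusCrossing_of_isPerturbationOne hρ hP hδ'pos
  -- Step 2: the two cases `d = d₀` / `d = d₁`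
  rcases le_total (Q.sideDist 1) (Q.sideDist 0) with h10 | h01
  · -- `d = d₀`: open arm, RSW
    have hd0 : d = Q.sideDist 0 := by rw [hd, Quad.sizeParam, max_eq_left h10]
    obtain ⟨R, hR⟩ : ∃ R : ℝ, R = Q.sideDist 0 / 2 - 2 * ρ := ⟨_, rfl⟩
    have hρR : ρ < R := by linarith
    obtain ⟨r'', hr''⟩ : ∃ r'' : ℝ, r'' = max (ρ + δ') (c₀ * δ') := ⟨_, rfl⟩
    have hsub : symmDiff {ω | Q ∈ z2QuadConfig D δ' ω} {ω | Q' ∈ z2QuadConfig D δ' ω} ⊆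
        annulusOpenCrossing a δ' r'' (R - δ') := by
      rw [hR, hr'']
      exact (hopen (hR ▸ hρR)).trans (annulusOpenCrossing_mono_left_aux a δ' (le_max_left _ _) _)
    have hr''δ : c₀ * δ' ≤ r'' := by rw [hr'']; exact le_max_right _ _
    have hr''le : r'' ≤ C₁ * ρ := by
      rw [hr'', max_le_iff, hC₁]
      constructor
      · nlinarith [mul_nonneg hc₀.le hρ.le]
      · nlinarith [hc₀]
    have hR'ge : d / 4 ≤ R - δ' := by linarith
    have h2r : 2 * r'' ≤ R - δ' := by linarith
    have hRSW' := hRSW a δ' r'' (R - δ') hδ'pos hr''δ h2r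
    refine (measureReal_mono hsub (measure_ne_top _ _)).trans (hRSW'.trans ?_)
    have hbase : r'' / (R - δ') ≤ 16 * C₁ * ρ / d := by
      rw [div_le_div_iff₀ (by linarith) hdpos]
      have h3 : 0 ≤ C₁ * ρ * (R - δ') := mul_nonneg hCρ (by linarith)
      nlinarith
    have hr''nn : 0 ≤ r'' / (R - δ') := div_nonneg (le_trans (by positivity) hr''δ) (by linarith)
    exact Real.rpow_le_rpow hr''nn hbase hα.le
  · -- `d = d₁`: dual arm, RSW for closed crossings
    have hd1 : d = Q.sideDist 1 := by rw [hd, Quad.sizeParam, max_eq_right h01]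
    obtain ⟨R, hR⟩ : ∃ R : ℝ, R = Q.sideDist 1 / 2 - 2 * ρ := ⟨_, rfl⟩
    have hρR : ρ < R := by linarith
    have hrR : ρ + 2 * δ' ≤ R := by linarith
    obtain ⟨r'', hr''⟩ : ∃ r'' : ℝ, r'' = max (ρ + 2 * δ') (c₀ * δ') := ⟨_, rfl⟩
    have hsub : symmDiff {ω | Q ∈ z2QuadConfig D δ' ω} {ω | Q' ∈ z2QuadConfig D δ' ω} ⊆
        annulusDualCrossing a δ' r'' (R - 2 * δ') := by
      rw [hR, hr'']
      exact (hdual (hR ▸ hρR) (hR ▸ hrR)).trans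
        (annulusDualCrossing_mono_left_aux a δ' (le_max_left _ _) _)
    have hr''δ : c₀ * δ' ≤ r'' := by rw [hr'']; exact le_max_right _ _
    have hr''le : r'' ≤ C₁ * ρ := by
      rw [hr'', max_le_iff, hC₁]
      constructor
      · nlinarith [mul_nonneg hc₀.le hρ.le]
      · nlinarith [hc₀]
    have hR'ge : d / 4 ≤ R - 2 * δ' := by linarith
    have h2r : 2 * r'' ≤ R - 2 * δ' := by linarith
    have hRSW' := hRSWd a δ' r'' (R - 2 * δ') hδ'pos hr''δ h2r
    refine (measureReal_mono hsub (measure_ne_top _ _)).trans (hRSW'.trans ?_)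
    have hbase : r'' / (R - 2 * δ') ≤ 16 * C₁ * ρ / d := by
      rw [div_le_div_iff₀ (by linarith) hdpos]
      have h3 : 0 ≤ C₁ * ρ * (R - 2 * δ') := mul_nonneg hCρ (by linarith)
      nlinarith
    have hr''nn : 0 ≤ r'' / (R - 2 * δ') :=
      div_nonneg (le_trans (by positivity) hr''δ) (by linarith)
    exact Real.rpow_le_rpow hr''nn hbase hα.le

end QuadCrossing

end Literature.Probability.Percolation
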